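/- Width seat `ym-line-sfw-p2-w5` (prover-ym-line-sfw-p2-w5-g18-0), free hands on planner ym-idea-2 g16's LINE-19 entry kit
(crux `AllWindowsColdBox.BoxHighWindowsSU22` = stmt-QuantumFields-24004 / low item 24335, stub S4b `stub_landauRepresentative`, Stage I):
PART B of the planner's checked draft `l26/H4b0abc-LandauStageI-DRAFT.lean` (sha16 fa798203bc602e43), landed as its own module. -/
import Summits.QuantumFields.YangMills.Theorems.WeakCouplingRatesDefs
import Literature.MathematicalPhysics.QuantumLattice.LatticeGaugeDLR
import Literature.MathematicalPhysics.QuantumLattice.NarrowWellPlaquetteAction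

/-!
# The 2×2 key lemma of LINE-19 S4b Stage I (H4b.0b core): the SU(2) variational inequality forces Hermitian site matrices

For a `2×2` complex matrix `N` with REAL trace: if `Re tr (q·N) ≤ Re tr N` for every `q ∈ SU(2)`, then `Nᴴ = N`
(`SU2Key.conjTranspose_eq_of_forall_re_trace_le`).  Proof without `Matrix.exp`, square roots or derivatives: along the RATIONAL test
family `q = a•1 + c•(N − Nᴴ)` with `a = (1 − s²β)/(1 + s²β)`, `c = 2s/(1 + s²β)`, `β = β(N) = 4(Im N₀₀)² + |N₀₁ − conj N₁₀|² ≥ 0`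
(`testMat`, `testMat_mem`: it lies in `SU(2)` because `(N − Nᴴ)² = −β·1`, `antiHerm_sq`), one has `Re tr (qN) = a·Re tr N − c·β`
(`trace_testMat_mul_re`); a suitable `s < 0` in the inequality gives `β ≤ 0`, hence `β = 0`, hence `N` Hermitian
(`betaOf_eq_zero_of_forall`, `conjTranspose_eq_of_betaOf_eq_zero`).  Also: the trace of an `SU(2)` matrix is real (tree lemma `NarrowWell.trace_im_eq_zero`, reused — not restated) and so is the trace of its
adjoint (`trace_conjTranspose_im`).

This is the algebraic heart of H4b.0b «an interior minimiser of the lattice Landau functional is in lattice Landau gauge»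
(`Theorems/AllWindowsColdBoxBoxHighLineLandauMinimiser.lean`, PARTS A+C+D of the same kit; plan of record
`Cruxes/BoxHighWindowsSU22/STUB-PLAN-S4b.md`).  Author of the mathematics and of the Lean text: planner ym-idea-2 g16 (draft kit, `lean check`
rc 0); this seat only re-homed the namespace (`…AllWindowsColdBoxBoxHighLine.SU2Key`), spelled out `Matrix.specialUnitaryGroup (Fin 2) ℂ` for the
kit's local `SU2` abbreviation, and re-checked.  HONEST LABEL: helper lemmas toward ONE registered stub (S4b) of a critic-PASSed line on the
R2ξ″ RECORD-rung crux 24004; no stub is proved by name, no crux, rung or summit is proved; the Yang–Mills mass gap is NOT proved by this file.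
-/

set_option autoImplicit false

noncomputable section

open Matrix Complex ComplexConjugate

namespace Summit.QuantumFields.YangMills.Theorems.AllWindowsColdBoxBoxHighLine.SU2Key


/-- The anti-Hermitian part `B = N − Nᴴ` squares to the real scalar `−β`, `β = 4 y₀₀² + |N₀₁ − conj N₁₀|²`, when `tr N` is real. -/
theorem antiHerm_sq (N : Matrix (Fin 2) (Fin 2) ℂ) (htr : N.trace.im = 0) :
    (N - Nᴴ) * (N - Nᴴ) =
      -((4 * (N 0 0).im ^ 2 + ((N 0 1).re - (N 1 0).re) ^ 2 + ((N 0 1).im + (N 1 0).im) ^ 2 : ℝ) : ℂ) •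
        (1 : Matrix (Fin 2) (Fin 2) ℂ) := by
  have h11 : (N 1 1).im = -(N 0 0).im := by
    rw [Matrix.trace_fin_two, Complex.add_im] at htr; linarith
  set β : ℝ := 4 * (N 0 0).im ^ 2 + ((N 0 1).re - (N 1 0).re) ^ 2 + ((N 0 1).im + (N 1 0).im) ^ 2 with hβ
  ext i j
  fin_cases i <;> fin_cases j <;>
    simp [Matrix.mul_apply, Fin.sum_univ_two, Matrix.conjTranspose_apply, Complex.ext_iff,
      Complex.mul_re, Complex.mul_im, Complex.sub_re, Complex.sub_im, Complex.conj_re, Complex.conj_im,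
      Complex.ofReal_re, Complex.ofReal_im, h11] <;>
    (try constructor) <;> (try simp only [hβ]) <;> ring

/-- The real scalar `β(N) = 4 (Im N₀₀)² + |N₀₁ − conj N₁₀|² ≥ 0` (it vanishes iff `N` is Hermitian, given `tr N` real). -/
def betaOf (N : Matrix (Fin 2) (Fin 2) ℂ) : ℝ :=
  4 * (N 0 0).im ^ 2 + ((N 0 1).re - (N 1 0).re) ^ 2 + ((N 0 1).im + (N 1 0).im) ^ 2

/-- `β(N) ≥ 0`. -/
theorem betaOf_nonneg (N : Matrix (Fin 2) (Fin 2) ℂ) : 0 ≤ betaOf N := by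
  unfold betaOf; positivity

/-- The rational test family `q = a•1 + c•(N − Nᴴ)`. -/
def testMat (N : Matrix (Fin 2) (Fin 2) ℂ) (a c : ℝ) : Matrix (Fin 2) (Fin 2) ℂ :=
  (a : ℂ) • (1 : Matrix (Fin 2) (Fin 2) ℂ) + (c : ℂ) • (N - Nᴴ)

/-- `q = a•1 + c•(N − Nᴴ)` lies in `SU(2)` as soon as `a² + c² β(N) = 1` (`tr N` real). -/
theorem testMat_mem (N : Matrix (Fin 2) (Fin 2) ℂ) (htr : N.trace.im = 0) (a c : ℝ)
    (h : a ^ 2 + c ^ 2 * betaOf N = 1) : testMat N a c ∈ Matrix.specialUnitaryGroup (Fin 2) ℂ := by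
  have h11 : (N 1 1).im = -(N 0 0).im := by
    rw [Matrix.trace_fin_two, Complex.add_im] at htr; linarith
  simp only [betaOf] at h
  refine Matrix.mem_specialUnitaryGroup_iff.mpr ⟨Matrix.mem_unitaryGroup_iff'.mpr ?_, ?_⟩
  · ext i j
    fin_cases i <;> fin_cases j <;>
      simp [testMat, Matrix.mul_apply, Fin.sum_univ_two, Matrix.conjTranspose_apply, Matrix.one_apply, Complex.ext_iff,
        Complex.mul_re, Complex.mul_im, Complex.sub_re, Complex.sub_im, Complex.add_re, Complex.add_im,
        Complex.conj_re, Complex.conj_im, Complex.ofReal_re, Complex.ofReal_im, h11] <;>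
      (try constructor) <;> first | ring1 | linear_combination h
  · rw [Matrix.det_fin_two]
    simp [testMat, Matrix.conjTranspose_apply, Complex.ext_iff,
        Complex.mul_re, Complex.mul_im, Complex.sub_re, Complex.sub_im, Complex.add_re, Complex.add_im,
        Complex.conj_re, Complex.conj_im, Complex.ofReal_re, Complex.ofReal_im, h11]
    constructor <;> first | ring1 | linear_combination h

/-- Along the test family, `Re tr (q N) = a · Re tr N − c · β(N)`. -/
theorem trace_testMat_mul_re (N : Matrix (Fin 2) (Fin 2) ℂ) (htr : N.trace.im = 0) (a c : ℝ) :
    ((testMat N a c * N).trace).re = a * N.trace.re - c * betaOf N := by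
  have h11 : (N 1 1).im = -(N 0 0).im := by
    rw [Matrix.trace_fin_two, Complex.add_im] at htr; linarith
  simp only [betaOf, Matrix.trace_fin_two]
  simp [testMat, Matrix.mul_apply, Fin.sum_univ_two, Matrix.conjTranspose_apply, Matrix.one_apply,
      Complex.mul_re, Complex.mul_im, Complex.sub_re, Complex.sub_im, Complex.add_re, Complex.add_im,
      Complex.conj_re, Complex.conj_im, Complex.ofReal_re, Complex.ofReal_im, h11]
  ring

/-- `β(N) = 0` and `tr N` real force `N` Hermitian. -/
theorem conjTranspose_eq_of_betaOf_eq_zero (N : Matrix (Fin 2) (Fin 2) ℂ) (htr : N.trace.im = 0)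
    (hβz : betaOf N = 0) : Nᴴ = N := by
  have h11 : (N 1 1).im = -(N 0 0).im := by
    rw [Matrix.trace_fin_two, Complex.add_im] at htr; linarith
  unfold betaOf at hβz
  have hA : 0 ≤ 4 * (N 0 0).im ^ 2 := by positivity
  have hB : 0 ≤ ((N 0 1).re - (N 1 0).re) ^ 2 := sq_nonneg _
  have hC : 0 ≤ ((N 0 1).im + (N 1 0).im) ^ 2 := sq_nonneg _
  obtain ⟨hAB, hC0⟩ := (add_eq_zero_iff_of_nonneg (add_nonneg hA hB) hC).mp hβz
  obtain ⟨hA0, hB0⟩ := (add_eq_zero_iff_of_nonneg hA hB).mp hAB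
  have e00 : (N 0 0).im = 0 := by simpa using hA0
  have e01r : (N 0 1).re = (N 1 0).re := by rwa [sq_eq_zero_iff, sub_eq_zero] at hB0
  have e01i : (N 0 1).im = -(N 1 0).im := by rwa [sq_eq_zero_iff, add_eq_zero_iff_eq_neg] at hC0
  ext i j
  fin_cases i <;> fin_cases j <;>
    simp [Matrix.conjTranspose_apply, Complex.ext_iff, Complex.conj_re, Complex.conj_im, e00, e01r, e01i, h11]

/-- The variational inequality forces `β(N) = 0`. -/
theorem betaOf_eq_zero_of_forall (N : Matrix (Fin 2) (Fin 2) ℂ) (htr : N.trace.im = 0)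
    (hmin : ∀ q : Matrix.specialUnitaryGroup (Fin 2) ℂ, ((q : Matrix (Fin 2) (Fin 2) ℂ) * N).trace.re ≤ N.trace.re) : betaOf N = 0 := by
  have hβ0 : 0 ≤ betaOf N := betaOf_nonneg N
  -- the parameter `s < 0` with `s T + 1 > 0`, `T = Re tr N`
  obtain ⟨s, hs0, hsT⟩ : ∃ s : ℝ, s < 0 ∧ 0 < s * N.trace.re + 1 := by
    refine ⟨-1 / (2 * (N.trace.re ^ 2 + 1)), div_neg_of_neg_of_pos (by norm_num) (by positivity), ?_⟩
    have hpos : (0 : ℝ) < 2 * (N.trace.re ^ 2 + 1) := by positivity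
    have : -1 / (2 * (N.trace.re ^ 2 + 1)) * N.trace.re + 1 =
        (2 * N.trace.re ^ 2 - N.trace.re + 2) / (2 * (N.trace.re ^ 2 + 1)) := by
      field_simp; ring
    rw [this]
    exact div_pos (by nlinarith [sq_nonneg (N.trace.re - 1 / 4)]) hpos
  have hD0 : 0 < 1 + s ^ 2 * betaOf N := by positivity
  have hac : ((1 - s ^ 2 * betaOf N) / (1 + s ^ 2 * betaOf N)) ^ 2 +
      (2 * s / (1 + s ^ 2 * betaOf N)) ^ 2 * betaOf N = 1 := by
    have hD' : 1 + s ^ 2 * betaOf N ≠ 0 := hD0.ne'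
    field_simp
    ring
  -- evaluate the minimality at `q_s`
  have hq := hmin ⟨testMat N _ _, testMat_mem N htr _ _ hac⟩
  have hq' : (1 - s ^ 2 * betaOf N) / (1 + s ^ 2 * betaOf N) * N.trace.re -
      2 * s / (1 + s ^ 2 * betaOf N) * betaOf N ≤ N.trace.re := by
    have h := hq
    rw [trace_testMat_mul_re N htr] at h
    exact h
  have h3 : (1 - s ^ 2 * betaOf N) * N.trace.re - 2 * s * betaOf N ≤ N.trace.re * (1 + s ^ 2 * betaOf N) := by
    have h2 := mul_le_mul_of_nonneg_right hq' hD0.le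
    have e1 : ((1 - s ^ 2 * betaOf N) / (1 + s ^ 2 * betaOf N) * N.trace.re -
        2 * s / (1 + s ^ 2 * betaOf N) * betaOf N) * (1 + s ^ 2 * betaOf N) =
        (1 - s ^ 2 * betaOf N) * N.trace.re - 2 * s * betaOf N := by
      field_simp
    rw [e1] at h2
    exact h2
  have h5 : 0 < (-2 * s) * (s * N.trace.re + 1) := mul_pos (by linarith) hsT
  have h4 : betaOf N * ((-2 * s) * (s * N.trace.re + 1)) ≤ 0 := by nlinarith [h3]
  have hβle : betaOf N ≤ 0 := by
    by_contra hcon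
    push Not at hcon
    nlinarith [mul_pos hcon h5]
  exact le_antisymm hβle hβ0

/-- **KEY LEMMA (H4b.0b core).** If `tr N` is real and `Re tr (q N) ≤ Re tr N` for all `q ∈ SU(2)`, then `N` is Hermitian. -/
theorem conjTranspose_eq_of_forall_re_trace_le (N : Matrix (Fin 2) (Fin 2) ℂ) (htr : N.trace.im = 0)
    (hmin : ∀ q : Matrix.specialUnitaryGroup (Fin 2) ℂ, ((q : Matrix (Fin 2) (Fin 2) ℂ) * N).trace.re ≤ N.trace.re) : Nᴴ = N :=
  conjTranspose_eq_of_betaOf_eq_zero N htr (betaOf_eq_zero_of_forall N htr hmin)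

/-- The trace of an `SU(2)` matrix is real (tree: `Literature.MathematicalPhysics.QuantumLattice.NarrowWell.trace_im_eq_zero`), hence so is the
trace of its adjoint, and differences of sums of `SU(2)` matrices and their adjoints have real trace. -/
theorem trace_conjTranspose_im (W : Matrix.specialUnitaryGroup (Fin 2) ℂ) : ((W : Matrix (Fin 2) (Fin 2) ℂ)ᴴ.trace).im = 0 := by
  rw [Matrix.trace_conjTranspose, Complex.star_def, Complex.conj_im,
    Literature.MathematicalPhysics.QuantumLattice.NarrowWell.trace_im_eq_zero, neg_zero]

end Summit.QuantumFields.YangMills.Theorems.AllWindowsColdBoxBoxHighLine.SU2Key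

end
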